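import Summits.QuantumFields.YangMills.Theorems.ColdStartUniversalityShenZhuZhuConcentrationSU2
import Summits.Ventures.YMGap.RobustBall.LoopObservable
import Literature.MathematicalPhysics.QuantumFieldTheory.Z2WilsonLoopGKS
import HarnessLib

/-!
# Gaussian concentration of WILSON LOOPS under every infinite-volume limit point of three-dimensional `SU(2)`
# lattice Yang–Mills at strong coupling (`|β| < 1/24`, 't Hooft scaling)

Seat `ym-line-csu-p1` (g38), route `ColdStartUniversality` of `Summits/QuantumFields/YangMills`, helper file G5 — a COROLLARY of the
seat's Herbst concentration theorem `szz_concentration_su2_sharp` (`…ShenZhuZhuConcentrationSU2`, g38) for the physically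
relevant observables: the Wilson loop `W_C(U) = ½ Re tr hol_C(U)` of a closed lattice walk `C` in `ℤ³` (tree `wilsonLoopObs` of the
normalised fundamental character, `walkHolonomy`, `loopExpectation`).

* `exists_smooth_linkLipschitz_wilsonLoopObs` (every `d`, `N`) — the Wilson loop observable of a closed walk `C` IS a smooth matrix
  cylinder function over the links of `C` (`matrixCylinder (walkEdges C) f`), `mult_C(e)/√N`-Lipschitz in the link `e` for the Frobenius
  distance, `mult_C(e)` = the venture's dart multiplicity `dartMult C e` (the word `(1/N) Re tr Π_k M_{e_k}^{(ᴴ)}` in the link matrices;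
  one-link telescoping = venture `RobustBall.abs_fundChar_walkHolonomy_sub_le`).
* ★★★ `szz_wilsonLoop_upperTail_su2`, `szz_wilsonLoop_lowerTail_su2`, `szz_wilsonLoop_twoSided_su2` — for EVERY infinite-volume limit
  point `μ` of the periodic Wilson states of `SU(2)` lattice Yang–Mills on `ℤ³` at 't Hooft coupling `|β| < 1/24` (tree coupling `2β`),
  every closed walk `C` of positive length and every `r ≥ 0`:
  `μ{W_C ≥ ⟨W_C⟩_μ + r} ≤ exp(−(1 − 24|β|) r² / Σ_{e ∈ C} mult_C(e)²)`, the same for the lower tail, and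
  `μ{|W_C − ⟨W_C⟩_μ| ≥ r} ≤ 2 exp(−(1 − 24|β|) r² / Σ_e mult_C(e)²)`.
* ★★★ `szz_wilsonLoop_twoSided_su2_of_isTrail` — for a closed TRAIL `C` (no lattice link used twice, e.g. every rectangle):
  `μ{|W_C − ⟨W_C⟩_μ| ≥ r} ≤ 2 exp(−(1 − 24|β|) r² / |C|)`: Gaussian concentration at scale `√|C|` — the PERIMETER — uniformly over all
  infinite-volume limit points.  Shen–Zhu–Zhu (CMP 400 (2023), Cor. 1.5 / Remark 4.6) print the variance bound `Var(W_C) ≲ |C|/(K_S N)`; the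
  venture `YMGap` (`RobustBall.WilsonLoopVarianceDLR`) has the variance bound for DLR states; the exponential tail is new in the tree.
* `szz_wilsonLoop_laplace_su2` — the exponential-moment bound `μ(e^{λ W_C}) ≤ exp(λ⟨W_C⟩ + λ² Σ_e mult² /(4(1 − 24|β|)))`, `λ ≥ 0`.

THEOREMS ONLY, no definition, no sorry.  HONEST FRAMING: STRONG coupling (`|β| < 1/24` 't Hooft), fixed lattice, `SU(2)`, `d = 3`; nothing
at weak coupling / in the continuum, no area law, nothing `K`-uniform along the route's scaling (`UniformColdStartMixing`, 24809, ASIDE, not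
restated); no crux, rung or summit statement is proved; the Yang–Mills mass gap is NOT proved.

References: H. Shen, R. Zhu, X. Zhu, *A stochastic analysis approach to lattice Yang–Mills at strong coupling*, CMP 400 (2023) 805–851
= arXiv:2204.12737, Thm 1.4, Cor. 1.5, Rem. 4.6 [ShenZhuZhu2022]; M. Ledoux, *The concentration of measure phenomenon*, AMS (2001), §5.1
(Herbst argument).
-/

set_option autoImplicit false

noncomputable section

namespace Summit.QuantumFields.YangMills.Theorems.ColdStartUniversality

open MeasureTheory ProbabilityTheory Finset Filter Set
open scoped BigOperators NNReal ENNReal Topology Matrix Matrix.Norms.Frobenius ContDiff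
open SimpleGraph
open Literature.Probability.LatticeModels (Site zdGraph)
open Literature.MathematicalPhysics.QuantumFieldTheory
open Literature.MathematicalPhysics.QuantumLattice (fundamentalRep fundamentalRep_apply infiniteVolumeLimitPoints LGConfig
  normalisedCharacter dartStep dartHolonomy walkHolonomy wilsonLoopObs loopExpectation)
open Summit.Ventures.YMGap.RobustBall (dartMult abs_fundChar_walkHolonomy_sub_le sum_walkEdges_dartMult one_le_dartMult_of_mem)

/-! ## §1. The Wilson loop observable is a smooth, link-Lipschitz matrix cylinder function -/

/-- **The Wilson loop observable of a closed walk is a smooth Lipschitz cylinder function.**  For every closed walk `C` in `ℤ^d`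
there is a `C^∞` function `f` of the link matrices over the links of `C` with `matrixCylinder (walkEdges C) f = W_C`
(`W_C = (1/N) Re tr hol_C`, the Wilson loop observable of the normalised fundamental character) which is
`mult_C(e)/√N`-Lipschitz in each link `e` for the Frobenius distance on `SU(N)` (`mult_C(e)` = number of darts of `C` over `e`).
The function is the word `M ↦ (1/N) Re tr Π_k M_{e_k}^{(ᴴ)}` over the darts of `C`. [folklore] -/
theorem exists_smooth_linkLipschitz_wilsonLoopObs {d N : ℕ} {x : Site d} (w : (zdGraph d).Walk x x) :
    ∃ f : (↥(walkEdges w) → Matrix (Fin N) (Fin N) ℂ) → ℝ,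
      ContDiff ℝ ∞ f ∧
      (∀ U : LGConfig d (Matrix.specialUnitaryGroup (Fin N) ℂ),
        matrixCylinder (walkEdges w) f U =
          wilsonLoopObs (fun g : Matrix.specialUnitaryGroup (Fin N) ℂ => normalisedCharacter N (fundamentalRep (Fin N) g)) w U) ∧
      (∀ (e : ↥(walkEdges w)) (M M' : ↥(walkEdges w) → Matrix.specialUnitaryGroup (Fin N) ℂ),
        (∀ e', e' ≠ e → M e' = M' e') →
        |f (fun e' => (M e' : Matrix (Fin N) (Fin N) ℂ)) - f (fun e' => (M' e' : Matrix (Fin N) (Fin N) ℂ))| ≤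
          (dartMult w (e : Literature.MathematicalPhysics.QuantumLattice.ZdEdge d) : ℝ) / Real.sqrt (N : ℝ) *
            suFrobDist (M e) (M' e)) := by
  classical
  set Λ : Finset (Literature.MathematicalPhysics.QuantumLattice.ZdEdge d) := walkEdges w with hΛ
  -- extension of a link family by `1` off `Λ`, the step matrices `M_e` / `M_eᴴ`, and the word
  set ext : (↥Λ → Matrix (Fin N) (Fin N) ℂ) → Literature.MathematicalPhysics.QuantumLattice.ZdEdge d →
      Matrix (Fin N) (Fin N) ℂ := fun m z => if h : z ∈ Λ then m ⟨z, h⟩ else 1 with hext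
  set step : (↥Λ → Matrix (Fin N) (Fin N) ℂ) → (zdGraph d).Dart → Matrix (Fin N) (Fin N) ℂ :=
    fun m a => if (dartStep a).2 then ext m (dartStep a).1 else (ext m (dartStep a).1)ᴴ with hstep
  set fW : (↥Λ → Matrix (Fin N) (Fin N) ℂ) → ℝ := fun m => normalisedCharacter N ((w.darts.map (step m)).prod) with hfW
  -- (1) the identity `matrixCylinder Λ fW = W_C`
  have hrep : ∀ U : LGConfig d (Matrix.specialUnitaryGroup (Fin N) ℂ), matrixCylinder Λ fW U =
      wilsonLoopObs (fun g : Matrix.specialUnitaryGroup (Fin N) ℂ => normalisedCharacter N (fundamentalRep (Fin N) g)) w U := by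
    intro U
    unfold matrixCylinder wilsonLoopObs
    simp only [hfW, fundamentalRep_apply]
    congr 1
    unfold walkHolonomy
    rw [Submonoid.coe_list_prod, List.map_map]
    refine congrArg List.prod (List.map_congr_left fun a ha => ?_)
    have hmem : (dartStep a).1 ∈ Λ := by
      rw [hΛ]; unfold walkEdges
      exact List.mem_toFinset.2 (List.mem_map.2 ⟨a, ha, rfl⟩)
    simp only [hstep, hext, dif_pos hmem, Function.comp_apply, dartHolonomy]
    split_ifs
    · rfl
    · exact (su_coe_inv _).symm
  -- (2) smoothness: a polynomial in the entries
  have hext_cd : ∀ z, ContDiff ℝ ∞ (fun m : ↥Λ → Matrix (Fin N) (Fin N) ℂ => ext m z) := by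
    intro z
    by_cases hz : z ∈ Λ
    · have h1 : (fun m : ↥Λ → Matrix (Fin N) (Fin N) ℂ => ext m z) = fun m => m ⟨z, hz⟩ := by
        funext m; simp only [hext, dif_pos hz]
      rw [h1]; exact contDiff_apply ℝ (Matrix (Fin N) (Fin N) ℂ) (⟨z, hz⟩ : ↥Λ)
    · have h1 : (fun m : ↥Λ → Matrix (Fin N) (Fin N) ℂ => ext m z) = fun _ => 1 := by
        funext m; simp only [hext, dif_neg hz]
      rw [h1]; exact contDiff_const
  have hct : ContDiff ℝ ∞ (fun M : Matrix (Fin N) (Fin N) ℂ => Mᴴ) := by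
    let T : Matrix (Fin N) (Fin N) ℂ →L[ℝ] Matrix (Fin N) (Fin N) ℂ :=
      LinearMap.toContinuousLinearMap
        { toFun := fun M => Mᴴ
          map_add' := fun A B => Matrix.conjTranspose_add A B
          map_smul' := fun c A => by rw [Matrix.conjTranspose_smul, star_trivial, RingHom.id_apply] }
    exact T.contDiff
  have hstep_cd : ∀ a, ContDiff ℝ ∞ (fun m : ↥Λ → Matrix (Fin N) (Fin N) ℂ => step m a) := by
    intro a
    cases hb : (dartStep a).2
    · have h1 : (fun m : ↥Λ → Matrix (Fin N) (Fin N) ℂ => step m a) = fun m => (ext m (dartStep a).1)ᴴ := by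
        funext m; simp only [hstep, hb, Bool.false_eq_true, if_false]
      rw [h1]; exact hct.comp (hext_cd _)
    · have h1 : (fun m : ↥Λ → Matrix (Fin N) (Fin N) ℂ => step m a) = fun m => ext m (dartStep a).1 := by
        funext m; simp only [hstep, hb, if_true]
      rw [h1]; exact hext_cd _
  have hword : ∀ l : List ((zdGraph d).Dart),
      ContDiff ℝ ∞ (fun m : ↥Λ → Matrix (Fin N) (Fin N) ℂ => (l.map (step m)).prod) := by
    intro l
    induction l with
    | nil =>
      simp only [List.map_nil, List.prod_nil]
      exact contDiff_const
    | cons a l ih =>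
      simp only [List.map_cons, List.prod_cons]
      exact (hstep_cd a).mul ih
  have hrt : ContDiff ℝ ∞ (fun M : Matrix (Fin N) (Fin N) ℂ => M.trace.re) := by
    let T : Matrix (Fin N) (Fin N) ℂ →L[ℝ] ℝ :=
      LinearMap.toContinuousLinearMap
        { toFun := fun M => M.trace.re
          map_add' := fun A B => by simp [Matrix.trace_add]
          map_smul' := fun r A => by simp [Matrix.trace_smul] }
    exact T.contDiff
  have hcd : ContDiff ℝ ∞ fW := by
    rw [hfW]
    unfold normalisedCharacter
    exact contDiff_const.mul (hrt.comp (hword w.darts))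
  -- (3) the Lipschitz bound, from the venture's configuration-level telescoping
  refine ⟨fW, hcd, hrep, fun e M M' hMM' => ?_⟩
  set U : LGConfig d (Matrix.specialUnitaryGroup (Fin N) ℂ) := fun z => if h : z ∈ Λ then M ⟨z, h⟩ else 1 with hU
  set V : LGConfig d (Matrix.specialUnitaryGroup (Fin N) ℂ) := fun z => if h : z ∈ Λ then M' ⟨z, h⟩ else 1 with hV
  have hUM : (fun e' : ↥Λ => ((U e' : Matrix.specialUnitaryGroup (Fin N) ℂ) : Matrix (Fin N) (Fin N) ℂ)) =
      fun e' => (M e' : Matrix (Fin N) (Fin N) ℂ) := by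
    funext e'; simp only [hU, dif_pos e'.2, Subtype.coe_eta]
  have hVM : (fun e' : ↥Λ => ((V e' : Matrix.specialUnitaryGroup (Fin N) ℂ) : Matrix (Fin N) (Fin N) ℂ)) =
      fun e' => (M' e' : Matrix (Fin N) (Fin N) ℂ) := by
    funext e'; simp only [hV, dif_pos e'.2, Subtype.coe_eta]
  have hUV : ∀ z, z ≠ (e : Literature.MathematicalPhysics.QuantumLattice.ZdEdge d) → U z = V z := by
    intro z hz
    by_cases h : z ∈ Λ
    · have hne : (⟨z, h⟩ : ↥Λ) ≠ e := fun h' => hz (congrArg Subtype.val h')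
      simp only [hU, hV, dif_pos h, hMM' _ hne]
    · simp only [hU, hV, dif_neg h]
  have hM1 : fW (fun e' => (M e' : Matrix (Fin N) (Fin N) ℂ)) =
      normalisedCharacter N (fundamentalRep (Fin N) (walkHolonomy U w)) := by
    rw [← hUM]; exact hrep U
  have hM2 : fW (fun e' => (M' e' : Matrix (Fin N) (Fin N) ℂ)) =
      normalisedCharacter N (fundamentalRep (Fin N) (walkHolonomy V w)) := by
    rw [← hVM]; exact hrep V
  have hUe : U e = M e := by simp only [hU, dif_pos e.2, Subtype.coe_eta]
  have hVe : V e = M' e := by simp only [hV, dif_pos e.2, Subtype.coe_eta]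
  have key := abs_fundChar_walkHolonomy_sub_le w (U := U) (V := V) hUV
  rw [hUe, hVe] at key
  rw [hM1, hM2]
  exact key

/-! ## §2. `SU(2)`, `d = 3`, `|β| < 1/24`: Gaussian tails of Wilson loops under every infinite-volume limit point -/

/-- Bookkeeping: `Σ_{e ∈ links(C)} mult_C(e)² ≥ |C| > 0` for a closed walk of positive length. [folklore] -/
theorem length_le_sum_dartMult_sq {d : ℕ} {x : Site d} (w : (zdGraph d).Walk x x) :
    (w.length : ℝ) ≤ ∑ e ∈ walkEdges w, (dartMult w e : ℝ) ^ 2 := by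
  rw [← sum_walkEdges_dartMult w, Nat.cast_sum]
  exact Finset.sum_le_sum fun e _ => by exact_mod_cast Nat.le_self_pow two_ne_zero (dartMult w e)

/-- Bookkeeping for trails: `Σ_{e ∈ links(C)} mult_C(e)² = |C|` when no link is used twice. [folklore] -/
theorem sum_dartMult_sq_eq_length_of_isTrail {d : ℕ} {x : Site d} {w : (zdGraph d).Walk x x} (hw : w.IsTrail) :
    ∑ e ∈ walkEdges w, (dartMult w e : ℝ) ^ 2 = w.length := by
  classical
  have hnd := nodup_map_dartStep_of_isTrail hw
  have hm1 : ∀ e ∈ walkEdges w, dartMult w e = 1 := by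
    intro e he
    refine le_antisymm ?_ (one_le_dartMult_of_mem w he)
    exact (@List.nodup_iff_count_le_one _ instBEqOfDecidableEq _ _).1 hnd e
  rw [← sum_walkEdges_dartMult w, Nat.cast_sum]
  refine Finset.sum_congr rfl fun e he => ?_
  rw [hm1 e he]; norm_num

/-- **Upper Gaussian tail of Wilson loops** under every infinite-volume limit point of `SU(2)` lattice Yang–Mills on `ℤ³` at 't Hooft
coupling `|β| < 1/24`: for every closed walk `C` of positive length and `r ≥ 0`,
`μ{W_C ≥ ⟨W_C⟩_μ + r} ≤ exp(−(1 − 24|β|) r² / Σ_{e ∈ links(C)} mult_C(e)²)`, `W_C = ½ Re tr hol_C`.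
Strong coupling, fixed lattice; the Yang–Mills mass gap is NOT proved. [cite: ShenZhuZhu2022, Theorem 1.4, Corollary 1.5] -/
theorem szz_wilsonLoop_upperTail_su2 {β : ℝ} (hβ : |β| < 1 / 24)
    {μ : Measure (LGConfig 3 (Matrix.specialUnitaryGroup (Fin 2) ℂ))}
    (hμ : μ ∈ infiniteVolumeLimitPoints (d := 3) (fundamentalRep (Fin 2)) (((2 : ℕ) : ℝ) * β))
    {x : Site 3} (w : (zdGraph 3).Walk x x) (hw : 0 < w.length) {r : ℝ} (hr : 0 ≤ r) :
    μ.real {U | loopExpectation μ (fun g : Matrix.specialUnitaryGroup (Fin 2) ℂ => normalisedCharacter 2 (fundamentalRep (Fin 2) g)) w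
        + r ≤ wilsonLoopObs (fun g : Matrix.specialUnitaryGroup (Fin 2) ℂ => normalisedCharacter 2 (fundamentalRep (Fin 2) g)) w U} ≤
      Real.exp (-((1 - 24 * |β|) * r ^ 2 / ∑ e ∈ walkEdges w, (dartMult w e : ℝ) ^ 2)) := by
  classical
  obtain ⟨f, hf, hrep, hLip⟩ := exists_smooth_linkLipschitz_wilsonLoopObs (N := 2) w
  set L : ↥(walkEdges w) → ℝ := fun e =>
    (dartMult w (e : Literature.MathematicalPhysics.QuantumLattice.ZdEdge 3) : ℝ) / Real.sqrt ((2 : ℕ) : ℝ) with hLdef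
  have hL : ∀ e, 0 ≤ L e := fun e => div_nonneg (Nat.cast_nonneg _) (Real.sqrt_nonneg _)
  have hsum : 2 * ∑ e, L e ^ 2 = ∑ e ∈ walkEdges w, (dartMult w e : ℝ) ^ 2 := by
    have h2 : Real.sqrt ((2 : ℕ) : ℝ) ^ 2 = 2 := by rw [Real.sq_sqrt (Nat.cast_nonneg _)]; norm_num
    simp only [hLdef, div_pow, h2]
    rw [← Finset.sum_div, Finset.sum_coe_sort (walkEdges w) (fun e => (dartMult w e : ℝ) ^ 2)]
    ring
  have hS : 0 < ∑ e, L e ^ 2 := by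
    have h1 := length_le_sum_dartMult_sq w
    have h0 : (0 : ℝ) < w.length := by exact_mod_cast hw
    linarith
  have key := szz_concentration_su2_sharp hβ hμ (walkEdges w) f hf L hL hS hLip hr
  have hF : matrixCylinder (walkEdges w) f =
      wilsonLoopObs (fun g : Matrix.specialUnitaryGroup (Fin 2) ℂ => normalisedCharacter 2 (fundamentalRep (Fin 2) g)) w := funext hrep
  rw [hF, hsum] at key
  exact key

/-- **Lower Gaussian tail of Wilson loops** (same setting): `μ{W_C ≤ ⟨W_C⟩_μ − r} ≤ exp(−(1 − 24|β|) r² / Σ_e mult_C(e)²)`.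
The Yang–Mills mass gap is NOT proved. [cite: ShenZhuZhu2022, Theorem 1.4, Corollary 1.5] -/
theorem szz_wilsonLoop_lowerTail_su2 {β : ℝ} (hβ : |β| < 1 / 24)
    {μ : Measure (LGConfig 3 (Matrix.specialUnitaryGroup (Fin 2) ℂ))}
    (hμ : μ ∈ infiniteVolumeLimitPoints (d := 3) (fundamentalRep (Fin 2)) (((2 : ℕ) : ℝ) * β))
    {x : Site 3} (w : (zdGraph 3).Walk x x) (hw : 0 < w.length) {r : ℝ} (hr : 0 ≤ r) :
    μ.real {U | wilsonLoopObs (fun g : Matrix.specialUnitaryGroup (Fin 2) ℂ => normalisedCharacter 2 (fundamentalRep (Fin 2) g)) w U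
        + r ≤ loopExpectation μ (fun g : Matrix.specialUnitaryGroup (Fin 2) ℂ => normalisedCharacter 2 (fundamentalRep (Fin 2) g)) w} ≤
      Real.exp (-((1 - 24 * |β|) * r ^ 2 / ∑ e ∈ walkEdges w, (dartMult w e : ℝ) ^ 2)) := by
  classical
  obtain ⟨f, hf, hrep, hLip⟩ := exists_smooth_linkLipschitz_wilsonLoopObs (N := 2) w
  set L : ↥(walkEdges w) → ℝ := fun e =>
    (dartMult w (e : Literature.MathematicalPhysics.QuantumLattice.ZdEdge 3) : ℝ) / Real.sqrt ((2 : ℕ) : ℝ) with hLdef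
  have hL : ∀ e, 0 ≤ L e := fun e => div_nonneg (Nat.cast_nonneg _) (Real.sqrt_nonneg _)
  have hsum : 2 * ∑ e, L e ^ 2 = ∑ e ∈ walkEdges w, (dartMult w e : ℝ) ^ 2 := by
    have h2 : Real.sqrt ((2 : ℕ) : ℝ) ^ 2 = 2 := by rw [Real.sq_sqrt (Nat.cast_nonneg _)]; norm_num
    simp only [hLdef, div_pow, h2]
    rw [← Finset.sum_div, Finset.sum_coe_sort (walkEdges w) (fun e => (dartMult w e : ℝ) ^ 2)]
    ring
  have hS : 0 < ∑ e, L e ^ 2 := by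
    have h1 := length_le_sum_dartMult_sq w
    have h0 : (0 : ℝ) < w.length := by exact_mod_cast hw
    linarith
  -- apply the concentration theorem to `-f`
  have hf' : ContDiff ℝ ∞ (fun m => - f m) := hf.neg
  have hLip' : ∀ (e : ↥(walkEdges w)) (M M' : ↥(walkEdges w) → Matrix.specialUnitaryGroup (Fin 2) ℂ),
      (∀ e', e' ≠ e → M e' = M' e') →
      |(fun m => - f m) (fun e' => (M e' : Matrix (Fin 2) (Fin 2) ℂ)) -
          (fun m => - f m) (fun e' => (M' e' : Matrix (Fin 2) (Fin 2) ℂ))| ≤ L e * suFrobDist (M e) (M' e) := by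
    intro e M M' h
    simp only [neg_sub_neg]
    rw [abs_sub_comm]
    exact hLip e M M' h
  have key := szz_concentration_su2_sharp hβ hμ (walkEdges w) (fun m => - f m) hf' L hL hS hLip' hr
  have hF : matrixCylinder (walkEdges w) (fun m => - f m) = fun U =>
      - wilsonLoopObs (fun g : Matrix.specialUnitaryGroup (Fin 2) ℂ => normalisedCharacter 2 (fundamentalRep (Fin 2) g)) w U := by
    funext U; rw [← hrep U]; rfl
  rw [hF, hsum] at key
  simp only [integral_neg] at key
  have hset : {U : LGConfig 3 (Matrix.specialUnitaryGroup (Fin 2) ℂ) |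
      wilsonLoopObs (fun g : Matrix.specialUnitaryGroup (Fin 2) ℂ => normalisedCharacter 2 (fundamentalRep (Fin 2) g)) w U + r ≤
        loopExpectation μ (fun g : Matrix.specialUnitaryGroup (Fin 2) ℂ => normalisedCharacter 2 (fundamentalRep (Fin 2) g)) w} =
      {U | -(∫ V, wilsonLoopObs (fun g : Matrix.specialUnitaryGroup (Fin 2) ℂ => normalisedCharacter 2 (fundamentalRep (Fin 2) g)) w V ∂μ)
        + r ≤ - wilsonLoopObs (fun g : Matrix.specialUnitaryGroup (Fin 2) ℂ => normalisedCharacter 2 (fundamentalRep (Fin 2) g)) w U} := by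
    ext U
    simp only [mem_setOf_eq, loopExpectation]
    constructor <;> intro h <;> linarith
  rw [hset]
  exact key

/-- **Two-sided Gaussian concentration of Wilson loops** under every infinite-volume limit point of `SU(2)` lattice Yang–Mills on `ℤ³`
at 't Hooft coupling `|β| < 1/24`: `μ{|W_C − ⟨W_C⟩_μ| ≥ r} ≤ 2 exp(−(1 − 24|β|) r² / Σ_{e ∈ links(C)} mult_C(e)²)` for every closed
walk `C` of positive length and every `r ≥ 0`.  The Yang–Mills mass gap is NOT proved. [cite: ShenZhuZhu2022, Theorem 1.4, Corollary 1.5] -/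
theorem szz_wilsonLoop_twoSided_su2 {β : ℝ} (hβ : |β| < 1 / 24)
    {μ : Measure (LGConfig 3 (Matrix.specialUnitaryGroup (Fin 2) ℂ))}
    (hμ : μ ∈ infiniteVolumeLimitPoints (d := 3) (fundamentalRep (Fin 2)) (((2 : ℕ) : ℝ) * β))
    {x : Site 3} (w : (zdGraph 3).Walk x x) (hw : 0 < w.length) {r : ℝ} (hr : 0 ≤ r) :
    μ.real {U | r ≤ |wilsonLoopObs (fun g : Matrix.specialUnitaryGroup (Fin 2) ℂ => normalisedCharacter 2 (fundamentalRep (Fin 2) g)) w U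
        - loopExpectation μ (fun g : Matrix.specialUnitaryGroup (Fin 2) ℂ => normalisedCharacter 2 (fundamentalRep (Fin 2) g)) w|} ≤
      2 * Real.exp (-((1 - 24 * |β|) * r ^ 2 / ∑ e ∈ walkEdges w, (dartMult w e : ℝ) ^ 2)) := by
  classical
  obtain ⟨Ls, hLs, hprob, hlim⟩ := hμ
  haveI := hprob
  have hμ' : μ ∈ infiniteVolumeLimitPoints (d := 3) (fundamentalRep (Fin 2)) (((2 : ℕ) : ℝ) * β) := ⟨Ls, hLs, hprob, hlim⟩
  set χ : Matrix.specialUnitaryGroup (Fin 2) ℂ → ℝ := fun g => normalisedCharacter 2 (fundamentalRep (Fin 2) g) with hχ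
  have h1 := szz_wilsonLoop_upperTail_su2 hβ hμ' w hw hr
  have h2 := szz_wilsonLoop_lowerTail_su2 hβ hμ' w hw hr
  have hsub : {U : LGConfig 3 (Matrix.specialUnitaryGroup (Fin 2) ℂ) | r ≤ |wilsonLoopObs χ w U - loopExpectation μ χ w|} ⊆
      {U | loopExpectation μ χ w + r ≤ wilsonLoopObs χ w U} ∪ {U | wilsonLoopObs χ w U + r ≤ loopExpectation μ χ w} := by
    intro U hU
    simp only [mem_setOf_eq, mem_union] at hU ⊢
    rcases le_abs'.1 hU with h | h
    · right; linarith
    · left; linarith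
  calc μ.real {U | r ≤ |wilsonLoopObs χ w U - loopExpectation μ χ w|}
      ≤ μ.real ({U | loopExpectation μ χ w + r ≤ wilsonLoopObs χ w U} ∪ {U | wilsonLoopObs χ w U + r ≤ loopExpectation μ χ w}) :=
        measureReal_mono hsub
    _ ≤ μ.real {U | loopExpectation μ χ w + r ≤ wilsonLoopObs χ w U} + μ.real {U | wilsonLoopObs χ w U + r ≤ loopExpectation μ χ w} :=
        measureReal_union_le _ _
    _ ≤ Real.exp (-((1 - 24 * |β|) * r ^ 2 / ∑ e ∈ walkEdges w, (dartMult w e : ℝ) ^ 2)) +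
          Real.exp (-((1 - 24 * |β|) * r ^ 2 / ∑ e ∈ walkEdges w, (dartMult w e : ℝ) ^ 2)) := add_le_add h1 h2
    _ = 2 * Real.exp (-((1 - 24 * |β|) * r ^ 2 / ∑ e ∈ walkEdges w, (dartMult w e : ℝ) ^ 2)) := by ring

/-- ★★★ **Gaussian concentration of Wilson loops at the PERIMETER scale, closed trails** (no lattice link used twice — e.g. every
rectangle): under every infinite-volume limit point of `SU(2)` lattice Yang–Mills on `ℤ³` at 't Hooft coupling `|β| < 1/24`,
`μ{|W_C − ⟨W_C⟩_μ| ≥ r} ≤ 2 exp(−(1 − 24|β|) r² / |C|)` for every closed trail `C` of positive length `|C|` and every `r ≥ 0`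
(Shen–Zhu–Zhu print the variance bound `Var(W_C) ≲ |C|/(K_S N)`, Cor. 1.5 / Rem. 4.6).  Strong coupling, fixed lattice; the Yang–Mills
mass gap is NOT proved. [cite: ShenZhuZhu2022, Theorem 1.4, Corollary 1.5, Remark 4.6] -/
theorem szz_wilsonLoop_twoSided_su2_of_isTrail {β : ℝ} (hβ : |β| < 1 / 24)
    {μ : Measure (LGConfig 3 (Matrix.specialUnitaryGroup (Fin 2) ℂ))}
    (hμ : μ ∈ infiniteVolumeLimitPoints (d := 3) (fundamentalRep (Fin 2)) (((2 : ℕ) : ℝ) * β))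
    {x : Site 3} {w : (zdGraph 3).Walk x x} (htr : w.IsTrail) (hw : 0 < w.length) {r : ℝ} (hr : 0 ≤ r) :
    μ.real {U | r ≤ |wilsonLoopObs (fun g : Matrix.specialUnitaryGroup (Fin 2) ℂ => normalisedCharacter 2 (fundamentalRep (Fin 2) g)) w U
        - loopExpectation μ (fun g : Matrix.specialUnitaryGroup (Fin 2) ℂ => normalisedCharacter 2 (fundamentalRep (Fin 2) g)) w|} ≤
      2 * Real.exp (-((1 - 24 * |β|) * r ^ 2 / w.length)) := by
  have h := szz_wilsonLoop_twoSided_su2 hβ hμ w hw hr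
  rw [sum_dartMult_sq_eq_length_of_isTrail htr] at h
  exact h

/-- **Exponential-moment (Laplace) bound for Wilson loops** under every infinite-volume limit point of `SU(2)` lattice Yang–Mills on `ℤ³`
at 't Hooft coupling `|β| < 1/24`: `μ(e^{λ W_C}) ≤ exp(λ ⟨W_C⟩_μ + λ² Σ_e mult_C(e)² / (4 (1 − 24|β|)))` for `λ ≥ 0`.
The Yang–Mills mass gap is NOT proved. [cite: ShenZhuZhu2022, Theorem 1.4] -/
theorem szz_wilsonLoop_laplace_su2 {β : ℝ} (hβ : |β| < 1 / 24)
    {μ : Measure (LGConfig 3 (Matrix.specialUnitaryGroup (Fin 2) ℂ))}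
    (hμ : μ ∈ infiniteVolumeLimitPoints (d := 3) (fundamentalRep (Fin 2)) (((2 : ℕ) : ℝ) * β))
    {x : Site 3} (w : (zdGraph 3).Walk x x) {l : ℝ} (hl : 0 ≤ l) :
    ∫ U, Real.exp (l * wilsonLoopObs (fun g : Matrix.specialUnitaryGroup (Fin 2) ℂ => normalisedCharacter 2 (fundamentalRep (Fin 2) g)) w U) ∂μ ≤
      Real.exp (l * loopExpectation μ (fun g : Matrix.specialUnitaryGroup (Fin 2) ℂ => normalisedCharacter 2 (fundamentalRep (Fin 2) g)) w
        + (∑ e ∈ walkEdges w, (dartMult w e : ℝ) ^ 2) / (4 * (1 - 24 * |β|)) * l ^ 2) := by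
  classical
  obtain ⟨f, hf, hrep, hLip⟩ := exists_smooth_linkLipschitz_wilsonLoopObs (N := 2) w
  set L : ↥(walkEdges w) → ℝ := fun e =>
    (dartMult w (e : Literature.MathematicalPhysics.QuantumLattice.ZdEdge 3) : ℝ) / Real.sqrt ((2 : ℕ) : ℝ) with hLdef
  have hL : ∀ e, 0 ≤ L e := fun e => div_nonneg (Nat.cast_nonneg _) (Real.sqrt_nonneg _)
  have hsum : ∑ e, L e ^ 2 = (∑ e ∈ walkEdges w, (dartMult w e : ℝ) ^ 2) / 2 := by
    have h2 : Real.sqrt ((2 : ℕ) : ℝ) ^ 2 = 2 := by rw [Real.sq_sqrt (Nat.cast_nonneg _)]; norm_num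
    simp only [hLdef, div_pow, h2]
    rw [← Finset.sum_div, Finset.sum_coe_sort (walkEdges w) (fun e => (dartMult w e : ℝ) ^ 2)]
  have key := szz_laplace_le_su2_sharp hβ hμ (walkEdges w) f hf L hL hLip hl
  have hF : matrixCylinder (walkEdges w) f =
      wilsonLoopObs (fun g : Matrix.specialUnitaryGroup (Fin 2) ℂ => normalisedCharacter 2 (fundamentalRep (Fin 2) g)) w := funext hrep
  rw [hF, hsum, div_div] at key
  have h4 : (2 : ℝ) * (2 * (1 - 24 * |β|)) = 4 * (1 - 24 * |β|) := by ring
  rw [h4] at key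
  exact key

end Summit.QuantumFields.YangMills.Theorems.ColdStartUniversality

end
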